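import Mathlib

/-!
# SoloBlind kernel #136 — the leaf-Floquet skeleton of the pattern-scale block (s78, §24.88)

Exact algebra behind the s78 audit of the composite's linearisation along a CLOSED carrier leaf:

* the *centrifugal (Görtler-type) loop*: a lift-up gain `b` (streak from roll, ∝ Re_p) closed by a
  curvature coupling `a = -2Vκ` (roll from streak) against damping `d` is the matrix `[[-d, a],[b, -d]]`,
  whose eigenvalues are `-d ± √(ab)`; it is unstable iff `d² < ab`, so the critical coupling
  `d²/b → 0` as the gain grows (`loop_unstable_iff`, `loop_onset_reynolds`);
* the local Rayleigh discriminant `κ (ω + Q s)`, `s = sin(nz) ∈ [-1,1]`, takes BOTH signs as soon as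
  the pattern shear `Q` exceeds the carrier vorticity `|ω|` (`discriminant_both_signs`);
* the *Floquet resonance*: a mode with multiplier `μ = ρ e^{iφ}` obstructs the steady (periodic)
  inverse exactly when `μ = 1`; `|1 - μ|² = 1 - 2ρ cos φ + ρ² ≥ (1-ρ)²` with equality structure
  `|1-μ| = 0 ↔ ρ = 1 ∧ cos φ = 1` (`resonance_modulus_*`), and for `μ = exp((s + iω)T)`:
  `μ = 1 ↔ sT = 0 ∧ ωT ∈ 2πℤ` (`resonance_iff`);
* the detuned-transit identity: growth `A√Re` acting for a time `B/√Re` gives an `Re`-free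
  exponent (`transit_exponent`).
-/

namespace Summit.AnomalousDissipation.AnomalousDissipation.Theorems

/-- The loop eigenvalues: `λ = -d ± √(ab)` solve the characteristic equation `(λ + d)² = ab`
of the matrix `[[-d, a], [b, -d]]` when `ab ≥ 0`. -/
theorem loop_eigenvalue (a b d : ℝ) (hab : 0 ≤ a * b) :
    ((-d + Real.sqrt (a * b)) + d) ^ 2 = a * b ∧ ((-d - Real.sqrt (a * b)) + d) ^ 2 = a * b := by
  have hs : Real.sqrt (a * b) ^ 2 = a * b := Real.sq_sqrt hab
  constructor <;> nlinarith [hs]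

/-- The characteristic polynomial of `[[-d, a], [b, -d]]` is `(λ + d)² - ab`. -/
theorem loop_charpoly (a b d lam : ℝ) :
    Matrix.det (lam • (1 : Matrix (Fin 2) (Fin 2) ℝ) - !![-d, a; b, -d]) = (lam + d) ^ 2 - a * b := by
  simp [Matrix.det_fin_two]
  ring

/-- The loop is unstable (its leading eigenvalue `-d + √(ab)` is positive) iff `d² < ab`. -/
theorem loop_unstable_iff (a b d : ℝ) (hd : 0 < d) (hab : 0 ≤ a * b) :
    0 < -d + Real.sqrt (a * b) ↔ d ^ 2 < a * b := by
  constructor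
  · intro h
    have h1 : d < Real.sqrt (a * b) := by linarith
    have h2 : d ^ 2 < Real.sqrt (a * b) ^ 2 := by
      apply sq_lt_sq' <;> nlinarith [Real.sqrt_nonneg (a * b)]
    rw [Real.sq_sqrt hab] at h2
    exact h2
  · intro h
    have h1 : Real.sqrt (d ^ 2) < Real.sqrt (a * b) := Real.sqrt_lt_sqrt (sq_nonneg d) h
    rw [Real.sqrt_sq hd.le] at h1
    linarith

/-- Onset in Reynolds-number form: with a fixed curvature coupling `c > 0` and a lift-up gain
`G · Re` proportional to the pattern Reynolds number, the loop is unstable iff `Re > d²/(cG)`: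
an `O(1/Re)` carrier coupling destabilises the frozen triangular (lift-up) structure. -/
theorem loop_onset_reynolds (c G d Re : ℝ) (hc : 0 < c) (hG : 0 < G) :
    d ^ 2 < c * (G * Re) ↔ d ^ 2 / (c * G) < Re := by
  have hcG : 0 < c * G := mul_pos hc hG
  rw [div_lt_iff₀ hcG]
  constructor <;> intro h <;> nlinarith

/-- The local Rayleigh discriminant `κ (ω + Q s)` over the pattern phase `s = sin(nz) ∈ [-1, 1]`
takes both signs as soon as the pattern shear `Q` exceeds the carrier vorticity `|ω|` and the leaf
is curved (`κ ≠ 0`): real local growth is available on half the vertical period, for either sign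
of `κ` and `ω`. -/
theorem discriminant_both_signs (κ ω Q : ℝ) (hκ : κ ≠ 0) (hQ : |ω| < Q) :
    (∃ s : ℝ, |s| ≤ 1 ∧ κ * (ω + Q * s) < 0) ∧ (∃ s : ℝ, |s| ≤ 1 ∧ 0 < κ * (ω + Q * s)) := by
  have h1 : ω + Q * 1 > 0 := by cases abs_lt.mp hQ; linarith
  have h2 : ω + Q * (-1) < 0 := by cases abs_lt.mp hQ; linarith
  rcases lt_or_gt_of_ne hκ with hneg | hpos
  · refine ⟨⟨1, by simp, ?_⟩, ⟨-1, by simp, ?_⟩⟩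
    · exact mul_neg_of_neg_of_pos hneg h1
    · exact mul_pos_of_neg_of_neg hneg h2
  · refine ⟨⟨-1, by simp, ?_⟩, ⟨1, by simp, ?_⟩⟩
    · exact mul_neg_of_pos_of_neg hpos h2
    · exact mul_pos hpos h1

/-- Floquet resonance, modulus form: for a multiplier `μ = ρ (cos φ + i sin φ)`,
`|1 - μ|² = (1 - ρ cos φ)² + (ρ sin φ)² = 1 - 2ρ cos φ + ρ²`. -/
theorem resonance_modulus_eq (ρ φ : ℝ) :
    (1 - ρ * Real.cos φ) ^ 2 + (ρ * Real.sin φ) ^ 2 = 1 - 2 * ρ * Real.cos φ + ρ ^ 2 := by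
  have h := Real.sin_sq_add_cos_sq φ
  nlinarith [h]

/-- `|1 - μ|² ≥ (1 - |μ|)²`: a mode away from the unit circle is harmless … -/
theorem resonance_modulus_lower (ρ φ : ℝ) (hρ : 0 ≤ ρ) :
    (1 - ρ) ^ 2 ≤ 1 - 2 * ρ * Real.cos φ + ρ ^ 2 := by
  have hc : Real.cos φ ≤ 1 := Real.cos_le_one φ
  nlinarith [mul_le_mul_of_nonneg_left hc hρ]

/-- … and `|1 - μ| = 0` exactly on the resonance `|μ| = 1`, `cos φ = 1`. -/
theorem resonance_modulus_zero_iff (ρ φ : ℝ) (hρ : 0 ≤ ρ) :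
    1 - 2 * ρ * Real.cos φ + ρ ^ 2 = 0 ↔ ρ = 1 ∧ Real.cos φ = 1 := by
  constructor
  · intro h
    have hc : Real.cos φ ≤ 1 := Real.cos_le_one φ
    have h1 : (1 - ρ) ^ 2 ≤ 0 := by nlinarith [mul_le_mul_of_nonneg_left hc hρ]
    have h2 : (1 - ρ) ^ 2 = 0 := le_antisymm h1 (sq_nonneg _)
    have hρ1 : ρ = 1 := by nlinarith [sq_eq_zero_iff.mp h2]
    subst hρ1
    constructor
    · rfl
    · linarith
  · rintro ⟨rfl, hc⟩
    rw [hc]; ring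

/-- Floquet resonance, exponent form: `exp((s + iω) T) = 1 ↔ sT = 0 ∧ ωT ∈ 2πℤ`.
A complex (Hopf-type) local exponent transported around a closed leaf obstructs the steady
inverse only through the winding of its phase `ωT` past multiples of `2π`. -/
theorem resonance_iff (s ω T : ℝ) :
    Complex.exp (((s : ℂ) + (ω : ℂ) * Complex.I) * (T : ℂ)) = 1 ↔
      s * T = 0 ∧ ∃ n : ℤ, ω * T = n * (2 * Real.pi) := by
  rw [Complex.exp_eq_one_iff]
  constructor
  · rintro ⟨n, hn⟩
    have hre := congrArg Complex.re hn
    have him := congrArg Complex.im hn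
    simp at hre him
    refine ⟨?_, ⟨n, by linarith⟩⟩
    rcases hre with h | h <;> simp [h]
  · rintro ⟨hs, ⟨n, hn⟩⟩
    refine ⟨n, ?_⟩
    apply Complex.ext
    · rcases mul_eq_zero.mp hs with h | h <;> simp [h]
    · simp
      linarith

/-- Detuned transit: a local growth rate `A √Re` acting during a passage time `B / √Re`
(the near-transverse band shrinking like `Re^{-1/2}`) yields the `Re`-independent exponent `AB`. -/
theorem transit_exponent (A B Re : ℝ) (hRe : 0 < Re) :
    (A * Real.sqrt Re) * (B / Real.sqrt Re) = A * B := by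
  have h : Real.sqrt Re ≠ 0 := (Real.sqrt_pos.mpr hRe).ne'
  field_simp

end Summit.AnomalousDissipation.AnomalousDissipation.Theorems
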